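import Summits.ValiantsHypothesis.ValiantsHypothesis.Theorems.LacunarySymmetroidMatrixDescartesPivotBilinearAll
import Summits.ValiantsHypothesis.ValiantsHypothesis.Theorems.LacunarySymmetroidMatrixDescartesCensusPivotBlockSum

/-!
# `MatrixDescartes` (stmt-ValiantsHypothesis-18050) — the bilinear family at every INDEX: `Z₊ ≥ j·(2(m−1)(K−1) + 2)` at
# format `(jm, K)`, pivot index `j`

HONEST FRAMING.  Cell `pub-symmetroid`, seat `val-sym-mdr-p2` (gen 24); helper file `--supports` the crux
`Theses.LacunarySymmetroid.MatrixDescartes` (OPEN), NO closure claim.  Bookkeeping corollary of `…PivotBilinearAll`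
(`not_pivotRootLawAt_bilinear`: the index-ONE row fails below `2(m−1)(K−1) + 2` at every `(m, K)`) and seat g7's block-sum
propagation `Pivot.not_pivotRootLawAt_mul` (direct sums on a common support add sizes, indices and root counts): for every
`m ≥ 1`, `K ≥ 2`, `j ≥ 1`, **`not_pivotRootLawAt_bilinear_mul : ¬ PivotRootLawAt (j·m) K j (j·(2(m−1)(K−1) + 2) − 1)`** — pivot pencils
of size `jm`, index `j`, `K` PSD letters reach `j·(2(m−1)(K−1) + 2)` positive roots.  The `K`-dependent law-level shapes PIL_K / PIL′
(`…CensusPivotDefs`) are consistent with this (their budgets exceed it); nothing is asserted about them.  Nothing here bears on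
`MatrixDescartes` in its window, on `DoorA26`/`DoorA34`, on the registers, or on `VP ≠ VNP`.
[folklore] Bookkeeping over the tree.
-/

set_option linter.dupNamespace false

namespace Summit.ValiantsHypothesis.ValiantsHypothesis.Theorems.LacunarySymmetroidMatrixDescartes.Pivot

/-- **The bilinear family at index `j`**: for `m ≥ 1`, `K ≥ 2`, `j ≥ 1`, the row «`Z₊ ≤ j·(2(m−1)(K−1)+2) − 1`» fails at format
`(j·m, K)`, pivot index `j` (`j` scale-separated copies of the stacked pole-weaving pencil). -/
theorem not_pivotRootLawAt_bilinear_mul (m K j : ℕ) (hm : 1 ≤ m) (hK : 2 ≤ K) (hj : 1 ≤ j) :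
    ¬ PivotRootLawAt (j * m) K j (j * (2 * (m - 1) * (K - 1) + 2) - 1) := by
  have h := not_pivotRootLawAt_mul (not_pivotRootLawAt_bilinear m K hm hK) hj
  simpa [Nat.mul_one, show 2 * (m - 1) * (K - 1) + 1 + 1 = 2 * (m - 1) * (K - 1) + 2 by omega] using h

/-- Budget form: a valid row at format `(j·m, K)`, index `j` (`m ≥ 1`, `K ≥ 2`, `j ≥ 1`) has budget `≥ j·(2(m−1)(K−1) + 2)`. -/
theorem le_of_pivotRootLawAt_index_mul {m K j B : ℕ} (hm : 1 ≤ m) (hK : 2 ≤ K) (hj : 1 ≤ j)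
    (h : PivotRootLawAt (j * m) K j B) : j * (2 * (m - 1) * (K - 1) + 2) ≤ B := by
  by_contra hB
  exact not_pivotRootLawAt_bilinear_mul m K j hm hK hj (pivotRootLawAt_mono h (by omega))

/-- In particular at FULL index (`m = 1`: size `j`, index `j`): `Z₊ ≥ 2j` for every `K ≥ 2` — the first-rung count `Z₊ ≤ q` of the
one-sided sector (`OneSidedIndexRung`) doubles as soon as letters sit on both sides of the pivot. -/
theorem not_pivotRootLawAt_full_index (j K : ℕ) (hK : 2 ≤ K) (hj : 1 ≤ j) : ¬ PivotRootLawAt j K j (2 * j - 1) := by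
  have h := not_pivotRootLawAt_bilinear_mul 1 K j le_rfl hK hj
  rw [show 2 * j - 1 = j * (2 * (1 - 1) * (K - 1) + 2) - 1 by omega]
  simpa [Nat.mul_one] using h

end Summit.ValiantsHypothesis.ValiantsHypothesis.Theorems.LacunarySymmetroidMatrixDescartes.Pivot
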